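import Mathlib.Geometry.Manifold.Instances.Icc
import Mathlib.Analysis.SpecialFunctions.Log.Deriv
import Mathlib.Analysis.SpecialFunctions.ExpDeriv
import Mathlib.Analysis.InnerProductSpace.Calculus
import Literature.Topology.FourManifolds.CorkDecompositionSplitting
import Literature.Topology.FourManifolds.CollarExtension
import Literature.Topology.FourManifolds.GluingCharts
import Literature.Topology.FourManifolds.SmoothEmbeddingCriteria
import HarnessLib

/-!
# Half-discs with prescribed flat face, from a collar of the boundary

Topic `Literature/Topology/FourManifolds`. This file reduces the named fact
`Literature.Topology.FourManifolds.exists_halfDisc_face_eq` of `CorkDecompositionSplitting.lean` (leaf (R0') under Matveyev's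
cork decomposition, `Literature.Topology.FourManifolds.Matveyev1996_decomposition`) to the collaring theorem
`Literature.Topology.FourManifolds.BoundaryData.nonempty_collar` of `Gluing.lean`:

* `Literature.exists_halfDisc_face_eq_of_nonempty_collar : BoundaryData.nonempty_collar →
  exists_halfDisc_face_eq`.

**Statement being reduced.** For a smooth manifold with boundary `A` of dimension `n + 2`
(model `𝓡∂ (n + 2)`), a boundary datum `b` of `A` (`∂A` as a smooth `(n+1)`-manifold `b.carrier`
with its embedding `b.incl`) and a smooth embedding `f : ℝⁿ⁺¹ → ∂A` with open range, there is a
smooth embedding `k : EuclideanHalfSpace (n + 2) → A` of the closed half space with open range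
whose flat face is `f`: `k (0, x') = b.incl (f x')`.

**Proof (the one printed in the docstring of the fact; Hirsch, *Differential Topology* (1976),
§4.6).** Let `c : ∂A × [0, 1] ↪ A` be a collar (`Literature.Topology.FourManifolds.BoundaryData.Collar`: a smooth embedding for
the product model `(𝓡 (n + 1)).prod (𝓡∂ 1)`, with `c (x, 0) = b.incl x` and open image of
`∂A × [0, 1)`). Put
`k (x₀, x') := c (f x', σ x₀)` with the diffeomorphism `σ : [0, ∞) ≅ [0, 1/2)`,
`σ s = (1 - e^{-s}) / 2` (`Literature.Topology.FourManifolds.collarSquash`, inverse `τ t = -log (1 - 2t)`,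
`Literature.Topology.FourManifolds.collarUnsquash`). Then:

1. `k` is smooth: it is the composite of the smooth lift
   `g : EuclideanHalfSpace (n + 2) → ∂A × [0, 1]`, `g (x₀, x') = (f x', σ x₀)`
   (`Literature.Topology.FourManifolds.halfDiscLift`; smooth into `[0, 1]` by Mathlib's `contMDiffOn_projIcc`) with the collar.
2. `g` is a homeomorphism onto the open set `C₀ = f(ℝⁿ⁺¹) × [0, 1/2)` of the cylinder, with the
   explicit inverse `G (y, t) = (τ t, f⁻¹ y)` (`Literature.Topology.FourManifolds.halfDiscUnlift`, written with the tree's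
   `BoundaryManifold.consCLE`), which is *smooth* on `C₀`:
   `f⁻¹` is smooth on the open range of `f` (the tree's
   `Literature.Topology.FourManifolds.contMDiffOn_leftInverse_of_isImmersion`, `SmoothEmbeddingCriteria.lean`), `τ` is smooth
   on `t < 1/2`, and `(𝓡∂ (n + 2)).symm` is smooth on the closed half space.
3. `k = c ∘ g` is an open topological embedding: `c` maps open sets below height `1` to open
   sets (`Literature.Topology.FourManifolds.BoundaryData.Collar.image_mem_nhds`, `CollarExtension.lean`).
4. `k⁻¹` is smooth on the range of `k`: by *descent along the collar*
   (`Literature.Topology.FourManifolds.contMDiffAt_of_comp_isImmersionAt_of_nhds`, `CollarExtension.lean`; Kosinski,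
   *Differential Manifolds* (1993), VI.1): `k⁻¹ ∘ c` agrees with the smooth `G` near every
   point of `C₀`, and `c` is an immersion open at points of height `< 1`.
5. Hence `k⁻¹ : k(H) → H` is a chart of the maximal atlas of `A`, and the chart criterion
   `Literature.Topology.FourManifolds.isSmoothEmbedding_of_symm_trans_chartAt_mem_maximalAtlas` (`GluingCharts.lean`) shows
   that `k` is a smooth embedding in Mathlib's sense (`Manifold.IsSmoothEmbedding`).
6. `k (0, x') = c (f x', 0) = b.incl (f x')` since `σ 0 = 0`.

The collar theorem itself (`Literature.Topology.FourManifolds.BoundaryData.nonempty_collar`, Hirsch Thm. 4.6.1) remains a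
named fact of the tree; it enters as a hypothesis.

## References

* M. W. Hirsch, *Differential Topology*, GTM 33, Springer (1976), §4.6 (collars), Thm. 4.6.1.
* A. A. Kosinski, *Differential Manifolds*, Academic Press (1993), Ch. VI §1 (smoothness by
  descent along the projections), §5 (boundary connected sum: half-discs on the boundary).
* A. Juhász, *Differential and Low-Dimensional Topology*, LMS Student Texts 104, CUP (2023),
  Def. 1.47 (half-discs `(H, D) ↪ (X, ∂X)` in the boundary connected sum).
* R. Matveyev, *A decomposition of smooth simply-connected h-cobordant 4-manifolds*,
  J. Differential Geom. 44 (1996), 571–582, proof of part 2 of the Theorem (fig. 2), where the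
  half-discs are used.

## Design notes

* Everything is in namespace `Literature`; no named facts are introduced. The new definitions
  (`collarSquash`, `collarUnsquash`, `halfDiscLift`, `halfDiscUnlift`, `halfDiscLiftRange`,
  `BoundaryData.Collar.halfDisc`) are the explicit formulas of the proof; the splitting
  `ℝⁿ⁺¹ × ℝ ≅ ℝⁿ⁺²` is the tree's `Literature.Topology.FourManifolds.BoundaryManifold.consCLE` / `tail` (`Cobordism.lean`).
* The smooth-embedding property is verified through the maximal atlas (chart criterion), not
  through a composition lemma for smooth embeddings (`Manifold.IsSmoothEmbedding.comp` is a
  Mathlib `proof_wanted`); the price is the explicit smooth inverse `G` of step 2.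
-/

open scoped Manifold ContDiff Topology
open Set Function Topology

noncomputable section

namespace Literature.Topology.FourManifolds

universe u

/-- Local notation: `𝔼 n` is the model Euclidean space `EuclideanSpace ℝ (Fin n)`. -/
local notation "𝔼 " n:arg => EuclideanSpace ℝ (Fin n)

/-! ### §1 Squashing `[0, ∞)` onto `[0, 1/2)` and back -/

section Squash

/-- The squashing function `σ s = (1 - e^{-s}) / 2`: a diffeomorphism of `[0, ∞)` onto
`[0, 1/2)`, smooth on all of `ℝ`, used to push the closed half space into the lower half of a
collar `∂A × [0, 1]`. [folklore] -/
def collarSquash (s : ℝ) : ℝ := (1 - Real.exp (-s)) / 2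

/-- The inverse `τ t = -log (1 - 2 t)` of the squashing function on `t < 1/2`. [folklore] -/
def collarUnsquash (t : ℝ) : ℝ := -Real.log (1 - 2 * t)

/-- `σ` is smooth. [folklore] -/
theorem contDiff_collarSquash : ContDiff ℝ ∞ collarSquash :=
  (contDiff_const.sub (Real.contDiff_exp.comp contDiff_neg)).div_const 2

/-- `σ 0 = 0`. [folklore] -/
@[simp] theorem collarSquash_zero : collarSquash 0 = 0 := by simp [collarSquash]

/-- `σ s < 1/2`. [folklore] -/
theorem collarSquash_lt_half (s : ℝ) : collarSquash s < 1 / 2 := by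
  have := Real.exp_pos (-s)
  unfold collarSquash
  linarith

/-- `0 ≤ σ s` for `0 ≤ s`. [folklore] -/
theorem collarSquash_nonneg {s : ℝ} (hs : 0 ≤ s) : 0 ≤ collarSquash s := by
  have : Real.exp (-s) ≤ 1 := Real.exp_le_one_iff.2 (by linarith)
  unfold collarSquash
  linarith

/-- `σ s ∈ [0, 1]` for `0 ≤ s`. [folklore] -/
theorem collarSquash_mem_Icc {s : ℝ} (hs : 0 ≤ s) : collarSquash s ∈ Icc (0 : ℝ) 1 :=
  ⟨collarSquash_nonneg hs, by linarith [collarSquash_lt_half s]⟩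

/-- `τ (σ s) = s`. [folklore] -/
@[simp] theorem collarUnsquash_collarSquash (s : ℝ) : collarUnsquash (collarSquash s) = s := by
  unfold collarUnsquash collarSquash
  have : 1 - 2 * ((1 - Real.exp (-s)) / 2) = Real.exp (-s) := by ring
  rw [this, Real.log_exp, neg_neg]

/-- `σ (τ t) = t` for `t < 1/2`. [folklore] -/
theorem collarSquash_collarUnsquash {t : ℝ} (ht : t < 1 / 2) :
    collarSquash (collarUnsquash t) = t := by
  unfold collarUnsquash collarSquash
  rw [neg_neg, Real.exp_log (by linarith)]
  ring

/-- `0 ≤ τ t` for `0 ≤ t < 1/2`. [folklore] -/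
theorem collarUnsquash_nonneg {t : ℝ} (h0 : 0 ≤ t) (ht : t < 1 / 2) : 0 ≤ collarUnsquash t := by
  unfold collarUnsquash
  have : Real.log (1 - 2 * t) ≤ 0 := Real.log_nonpos (by linarith) (by linarith)
  linarith

/-- `τ` is smooth at every `t < 1/2`. [folklore] -/
theorem contDiffAt_collarUnsquash {t : ℝ} (ht : t < 1 / 2) : ContDiffAt ℝ ∞ collarUnsquash t := by
  have h : ContDiffAt ℝ ∞ (fun t : ℝ => 1 - 2 * t) t :=
    contDiffAt_const.sub (contDiffAt_const.mul contDiffAt_id)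
  have h0 : (fun t : ℝ => 1 - 2 * t) t ≠ 0 := by
    show 1 - 2 * t ≠ 0
    linarith
  exact (h.log h0).neg

/-- `τ` is smooth on `(-∞, 1/2)`. [folklore] -/
theorem contDiffOn_collarUnsquash : ContDiffOn ℝ ∞ collarUnsquash (Iio (1 / 2)) :=
  fun _ ht => (contDiffAt_collarUnsquash ht).contDiffWithinAt

end Squash

/-! ### §2 First coordinate and tail of a vector of `ℝⁿ⁺¹` (bridges to `Cobordism.lean`) -/

section Coordinates

variable {n : ℕ}

/-- The first coordinate is a smooth (linear) function on `ℝⁿ⁺¹`. [folklore] -/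
theorem contDiff_euclidean_apply_zero : ContDiff ℝ ∞ (fun x : 𝔼 (n + 1) => x 0) :=
  (contDiff_apply ℝ ℝ 0).comp PiLp.contDiff_ofLp

/-- The face point `face x' = (0, x')` is `consCLE n (x', 0)` (the tree's splitting
`ℝⁿ × ℝ ≅ ℝⁿ⁺¹` of `Cobordism.lean`; indeed `face x' = BoundaryManifold.toHalfSpace n x'`
definitionally). [cite: Juhasz2023, Def. 1.47] -/
theorem val_face_eq_consCLE (x' : 𝔼 n) :
    (EuclideanHalfSpace.face x').val = BoundaryManifold.consCLE n (x', 0) := rfl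

/-- The tail of the face point `(0, x')` is `x'`. [cite: Juhasz2023, Def. 1.47] -/
@[simp] theorem tail_val_face (x' : 𝔼 n) :
    BoundaryManifold.tail n (EuclideanHalfSpace.face x').val = x' := by
  rw [val_face_eq_consCLE, BoundaryManifold.tail_consCLE]

/-- A vector with nonnegative first coordinate lies in the range of the model with boundary
`𝓡∂ (n + 1)` (the closed half space). [folklore] -/
theorem consCLE_mem_range_modelWithCorners (x' : 𝔼 n) {s : ℝ} (hs : 0 ≤ s) :
    BoundaryManifold.consCLE n (x', s) ∈ range (𝓡∂ (n + 1)) := by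
  rw [range_modelWithCornersEuclideanHalfSpace]
  exact hs

end Coordinates

/-! ### §3 The half-disc of a collar: the lift into the cylinder and its inverse -/

section HalfDisc

variable {n : ℕ} {A : Type u} [TopologicalSpace A] [ChartedSpace (EuclideanHalfSpace (n + 2)) A]
  {b : BoundaryData (𝓡∂ (n + 2)) A (𝓡 (n + 1))}

/-- **The lift of the closed half space into the cylinder over the boundary**:
`g (x₀, x') = (f x', σ x₀) ∈ ∂A × [0, 1]` (`σ = collarSquash`; the value `σ x₀ ∈ [0, 1/2)` is
entered through `Set.projIcc`, which is the identity there). [cite: Hirsch1976, §4.6] -/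
def halfDiscLift (f : 𝔼 (n + 1) → b.carrier) (v : EuclideanHalfSpace (n + 2)) :
    b.carrier × Set.Icc (0 : ℝ) 1 :=
  (f (BoundaryManifold.tail (n + 1) v.val), Set.projIcc 0 1 zero_le_one (collarSquash (v.val 0)))

/-- The open part `f(ℝⁿ⁺¹) × [0, 1/2)` of the cylinder hit by the lift. [cite: Hirsch1976, §4.6] -/
def halfDiscLiftRange (f : 𝔼 (n + 1) → b.carrier) : Set (b.carrier × Set.Icc (0 : ℝ) 1) :=
  range f ×ˢ {t : Set.Icc (0 : ℝ) 1 | (t : ℝ) < 1 / 2}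

/-- **The inverse of the lift** on `f(ℝⁿ⁺¹) × [0, 1/2)`: `G (y, t) = (τ t, f⁻¹ y)` for a left
inverse `finv` of `f` (`τ = collarUnsquash`), as a point of the closed half space through
`(𝓡∂ (n + 2)).symm` (the vector `(τ t, f⁻¹ y)` is `consCLE (n + 1) (f⁻¹ y, τ t)`).
[cite: Hirsch1976, §4.6] -/
def halfDiscUnlift (finv : b.carrier → 𝔼 (n + 1)) (q : b.carrier × Set.Icc (0 : ℝ) 1) :
    EuclideanHalfSpace (n + 2) :=
  (𝓡∂ (n + 2)).symm (BoundaryManifold.consCLE (n + 1) (finv q.1, collarUnsquash q.2))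

variable (f : 𝔼 (n + 1) → b.carrier)

/-- First component of the lift. [cite: Hirsch1976, §4.6] -/
@[simp] theorem halfDiscLift_fst (v : EuclideanHalfSpace (n + 2)) :
    (halfDiscLift f v).1 = f (BoundaryManifold.tail (n + 1) v.val) := rfl

/-- Height of the lift: `σ x₀`. [cite: Hirsch1976, §4.6] -/
theorem coe_halfDiscLift_snd (v : EuclideanHalfSpace (n + 2)) :
    ((halfDiscLift f v).2 : ℝ) = collarSquash (v.val 0) := by
  simp only [halfDiscLift]
  rw [Set.projIcc_of_mem _ (collarSquash_mem_Icc v.2)]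

/-- The lift stays strictly below height `1/2`. [cite: Hirsch1976, §4.6] -/
theorem halfDiscLift_snd_lt (v : EuclideanHalfSpace (n + 2)) :
    ((halfDiscLift f v).2 : ℝ) < 1 / 2 := by
  rw [coe_halfDiscLift_snd]
  exact collarSquash_lt_half _

/-- The lift stays strictly below height `1`. [cite: Hirsch1976, §4.6] -/
theorem halfDiscLift_snd_lt_one (v : EuclideanHalfSpace (n + 2)) :
    ((halfDiscLift f v).2 : ℝ) < 1 := by
  linarith [halfDiscLift_snd_lt f v]

/-- The lift takes values in `f(ℝⁿ⁺¹) × [0, 1/2)`. [cite: Hirsch1976, §4.6] -/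
theorem halfDiscLift_mem (v : EuclideanHalfSpace (n + 2)) : halfDiscLift f v ∈ halfDiscLiftRange f :=
  ⟨mem_range_self _, halfDiscLift_snd_lt f v⟩

/-- On the flat face the lift is `x' ↦ (f x', 0)`. [cite: Hirsch1976, §4.6] -/
theorem halfDiscLift_face (x' : 𝔼 (n + 1)) :
    halfDiscLift f (EuclideanHalfSpace.face x') = (f x', ⊥) := by
  refine Prod.ext ?_ (Subtype.ext ?_)
  · rw [halfDiscLift_fst, tail_val_face]
  · rw [coe_halfDiscLift_snd, EuclideanHalfSpace.val_face_apply_zero, collarSquash_zero]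
    rfl

variable {f} in
/-- `f(ℝⁿ⁺¹) × [0, 1/2)` is open in the cylinder when `f` has open range. [folklore] -/
theorem isOpen_halfDiscLiftRange (hfo : IsOpen (range f)) : IsOpen (halfDiscLiftRange f) :=
  hfo.prod (isOpen_lt continuous_subtype_val continuous_const)

variable {f} in
/-- **The lift is smooth** (`𝓡∂ (n + 2)` to the product model with corners
`(𝓡 (n + 1)).prod (𝓡∂ 1)`), for `f` smooth. [folklore] -/
theorem contMDiff_halfDiscLift (hf : ContMDiff (𝓡 (n + 1)) (𝓡 (n + 1)) ∞ f) :
    ContMDiff (𝓡∂ (n + 2)) ((𝓡 (n + 1)).prod (𝓡∂ 1)) ∞ (halfDiscLift f) := by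
  have hval : ContMDiff (𝓡∂ (n + 2)) 𝓘(ℝ, 𝔼 (n + 2)) ∞
      (fun v : EuclideanHalfSpace (n + 2) => v.val) :=
    (𝓡∂ (n + 2)).contMDiff
  have h1 : ContMDiff (𝓡∂ (n + 2)) (𝓡 (n + 1)) ∞
      (fun v : EuclideanHalfSpace (n + 2) => f (BoundaryManifold.tail (n + 1) v.val)) :=
    hf.comp ((BoundaryManifold.contDiff_tail (n + 1)).contMDiff.comp hval)
  have h2 : ContMDiff (𝓡∂ (n + 2)) 𝓘(ℝ, ℝ) ∞
      (fun v : EuclideanHalfSpace (n + 2) => collarSquash (v.val 0)) :=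
    contDiff_collarSquash.contMDiff.comp (contDiff_euclidean_apply_zero.contMDiff.comp hval)
  have h3 : ContMDiff (𝓡∂ (n + 2)) (𝓡∂ 1) ∞ (fun v : EuclideanHalfSpace (n + 2) =>
      Set.projIcc (0 : ℝ) 1 zero_le_one (collarSquash (v.val 0))) :=
    contMDiffOn_projIcc.comp_contMDiff h2 fun v => collarSquash_mem_Icc v.2
  exact h1.prodMk h3

variable {f} in
/-- The underlying vector of `G (y, t)` is `(τ t, finv y)` for `t < 1/2`. [folklore] -/
theorem val_halfDiscUnlift {finv : b.carrier → 𝔼 (n + 1)} {q : b.carrier × Set.Icc (0 : ℝ) 1}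
    (hq : (q.2 : ℝ) < 1 / 2) :
    (halfDiscUnlift finv q).val = BoundaryManifold.consCLE (n + 1) (finv q.1, collarUnsquash q.2) :=
  (𝓡∂ (n + 2)).right_inv
    (consCLE_mem_range_modelWithCorners _ (collarUnsquash_nonneg q.2.2.1 hq))

variable {f} in
/-- `G ∘ g = id` on the closed half space. [folklore] -/
theorem halfDiscUnlift_halfDiscLift {finv : b.carrier → 𝔼 (n + 1)} (hfinv : LeftInverse finv f)
    (v : EuclideanHalfSpace (n + 2)) : halfDiscUnlift finv (halfDiscLift f v) = v := by
  apply Subtype.ext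
  rw [val_halfDiscUnlift (halfDiscLift_snd_lt f v), halfDiscLift_fst, coe_halfDiscLift_snd, hfinv,
    collarUnsquash_collarSquash, BoundaryManifold.consCLE_tail]

variable {f} in
/-- `G` is a left inverse of `g`. [folklore] -/
theorem leftInverse_halfDiscUnlift {finv : b.carrier → 𝔼 (n + 1)} (hfinv : LeftInverse finv f) :
    LeftInverse (halfDiscUnlift finv) (halfDiscLift f) :=
  halfDiscUnlift_halfDiscLift hfinv

variable {f} in
/-- `g ∘ G = id` on `f(ℝⁿ⁺¹) × [0, 1/2)`. [folklore] -/
theorem halfDiscLift_halfDiscUnlift {finv : b.carrier → 𝔼 (n + 1)} (hfinv : LeftInverse finv f)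
    {q : b.carrier × Set.Icc (0 : ℝ) 1} (hq : q ∈ halfDiscLiftRange f) :
    halfDiscLift f (halfDiscUnlift finv q) = q := by
  obtain ⟨⟨x', hx'⟩, hq2⟩ := hq
  have hval := val_halfDiscUnlift (finv := finv) hq2
  refine Prod.ext ?_ (Subtype.ext ?_)
  · rw [halfDiscLift_fst, hval, BoundaryManifold.tail_consCLE]
    show f (finv q.1) = q.1
    rw [← hx', hfinv]
  · rw [coe_halfDiscLift_snd, hval, BoundaryManifold.consCLE_apply_zero]
    exact collarSquash_collarUnsquash hq2

variable {f} in
/-- The range of the lift is exactly `f(ℝⁿ⁺¹) × [0, 1/2)`. [folklore] -/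
theorem range_halfDiscLift {finv : b.carrier → 𝔼 (n + 1)} (hfinv : LeftInverse finv f) :
    range (halfDiscLift f) = halfDiscLiftRange f :=
  Subset.antisymm (range_subset_iff.2 (halfDiscLift_mem f)) fun _ hq =>
    ⟨_, halfDiscLift_halfDiscUnlift hfinv hq⟩

variable {f} in
/-- The image of an open set under the lift is open (the lift is a homeomorphism onto the open
set `f(ℝⁿ⁺¹) × [0, 1/2)`, with inverse `G` continuous there). [folklore] -/
theorem isOpen_image_halfDiscLift {finv : b.carrier → 𝔼 (n + 1)} (hfinv : LeftInverse finv f)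
    (hG : ContinuousOn (halfDiscUnlift finv) (halfDiscLiftRange f)) (hfo : IsOpen (range f))
    {U : Set (EuclideanHalfSpace (n + 2))} (hU : IsOpen U) : IsOpen (halfDiscLift f '' U) := by
  have hU' : halfDiscLift f '' U = halfDiscLiftRange f ∩ halfDiscUnlift finv ⁻¹' U := by
    ext q
    constructor
    · rintro ⟨v, hv, rfl⟩
      refine ⟨halfDiscLift_mem f v, ?_⟩
      rw [mem_preimage, halfDiscUnlift_halfDiscLift hfinv]
      exact hv
    · rintro ⟨hq, hqU⟩
      exact ⟨_, hqU, halfDiscLift_halfDiscUnlift hfinv hq⟩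
  rw [hU']
  exact hG.isOpen_inter_preimage (isOpen_halfDiscLiftRange hfo) hU

variable {f} in
/-- **The inverse of the lift is smooth on `f(ℝⁿ⁺¹) × [0, 1/2)`**, provided the left inverse
`finv` of `f` is smooth on the range of `f`. [folklore] -/
theorem contMDiffOn_halfDiscUnlift {finv : b.carrier → 𝔼 (n + 1)}
    (hfinv : ContMDiffOn (𝓡 (n + 1)) (𝓡 (n + 1)) ∞ finv (range f)) :
    ContMDiffOn ((𝓡 (n + 1)).prod (𝓡∂ 1)) (𝓡∂ (n + 2)) ∞ (halfDiscUnlift finv)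
      (halfDiscLiftRange f) := by
  have h1 : ContMDiffOn ((𝓡 (n + 1)).prod (𝓡∂ 1)) (𝓡 (n + 1)) ∞
      (fun q : b.carrier × Set.Icc (0 : ℝ) 1 => finv q.1) (halfDiscLiftRange f) :=
    hfinv.comp contMDiff_fst.contMDiffOn fun q hq => hq.1
  have h2 : ContMDiffOn ((𝓡 (n + 1)).prod (𝓡∂ 1)) 𝓘(ℝ, ℝ) ∞
      (fun q : b.carrier × Set.Icc (0 : ℝ) 1 => collarUnsquash q.2) (halfDiscLiftRange f) :=
    contDiffOn_collarUnsquash.contMDiffOn.comp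
      (contMDiff_subtype_coe_Icc.comp contMDiff_snd).contMDiffOn fun q hq => hq.2
  have h3 : ContMDiffOn ((𝓡 (n + 1)).prod (𝓡∂ 1)) 𝓘(ℝ, 𝔼 (n + 2)) ∞
      (fun q : b.carrier × Set.Icc (0 : ℝ) 1 =>
        BoundaryManifold.consCLE (n + 1) (finv q.1, collarUnsquash q.2)) (halfDiscLiftRange f) :=
    (BoundaryManifold.consCLE (n + 1)).contDiff.contMDiff.comp_contMDiffOn (h1.prodMk_space h2)
  exact (𝓡∂ (n + 2)).contMDiffOn_symm.comp h3 fun q hq =>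
    consCLE_mem_range_modelWithCorners _ (collarUnsquash_nonneg q.2.2.1 hq.2)

namespace BoundaryData.Collar

variable (c : b.Collar)

/-- **The half-disc of a collar along a disc of the boundary**: `k (x₀, x') = c (f x', σ x₀)`.
[cite: Hirsch1976, §4.6] -/
def halfDisc (f : 𝔼 (n + 1) → b.carrier) (v : EuclideanHalfSpace (n + 2)) : A :=
  c (halfDiscLift f v)

/-- Unfolding of the half-disc. [cite: Hirsch1976, §4.6] -/
theorem halfDisc_apply (v : EuclideanHalfSpace (n + 2)) : c.halfDisc f v = c (halfDiscLift f v) :=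
  rfl

/-- **The flat face of the half-disc is `f`**: `k (0, x') = b.incl (f x')`. [cite: Hirsch1976, §4.6] -/
theorem halfDisc_face (x' : 𝔼 (n + 1)) :
    c.halfDisc f (EuclideanHalfSpace.face x') = b.incl (f x') := by
  rw [halfDisc_apply, halfDiscLift_face, c.apply_bot]

/-- The image of a set under the half-disc is the image under the collar of its image under the
lift. [folklore] -/
theorem image_halfDisc (U : Set (EuclideanHalfSpace (n + 2))) :
    c.halfDisc f '' U = c '' (halfDiscLift f '' U) := by
  rw [image_image]
  rfl

/-- A collar maps open sets below height `1` to open sets. [folklore] -/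
theorem isOpen_image_of_forall_lt_one {U : Set (b.carrier × Set.Icc (0 : ℝ) 1)} (hU : IsOpen U)
    (h1 : ∀ q ∈ U, (q.2 : ℝ) < 1) : IsOpen (c '' U) := by
  rw [isOpen_iff_mem_nhds]
  rintro _ ⟨q, hq, rfl⟩
  exact c.image_mem_nhds (h1 q hq) (hU.mem_nhds hq)

variable {f}

/-- The half-disc is smooth, for `f` smooth. [folklore] -/
theorem contMDiff_halfDisc [IsManifold (𝓡∂ (n + 2)) ∞ A]
    (hf : ContMDiff (𝓡 (n + 1)) (𝓡 (n + 1)) ∞ f) :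
    ContMDiff (𝓡∂ (n + 2)) (𝓡∂ (n + 2)) ∞ (c.halfDisc f) :=
  c.isSmoothEmbedding.contMDiff.comp (contMDiff_halfDiscLift hf)

/-- The half-disc is an open map, provided `f` has open range and a left inverse `finv` for
which `G` is continuous on `f(ℝⁿ⁺¹) × [0, 1/2)`. [folklore] -/
theorem isOpenMap_halfDisc {finv : b.carrier → 𝔼 (n + 1)} (hfinv : LeftInverse finv f)
    (hG : ContinuousOn (halfDiscUnlift finv) (halfDiscLiftRange f)) (hfo : IsOpen (range f)) :
    IsOpenMap (c.halfDisc f) := by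
  intro U hU
  rw [image_halfDisc]
  refine c.isOpen_image_of_forall_lt_one (isOpen_image_halfDiscLift hfinv hG hfo hU) ?_
  rintro _ ⟨v, -, rfl⟩
  exact halfDiscLift_snd_lt_one f v

/-- The half-disc has open range (same hypotheses). [folklore] -/
theorem isOpen_range_halfDisc {finv : b.carrier → 𝔼 (n + 1)} (hfinv : LeftInverse finv f)
    (hG : ContinuousOn (halfDiscUnlift finv) (halfDiscLiftRange f)) (hfo : IsOpen (range f)) :
    IsOpen (range (c.halfDisc f)) := by
  rw [← image_univ]
  exact c.isOpenMap_halfDisc hfinv hG hfo _ isOpen_univ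

/-- The half-disc is injective, for `f` injective (with left inverse `finv`). [folklore] -/
theorem injective_halfDisc {finv : b.carrier → 𝔼 (n + 1)} (hfinv : LeftInverse finv f) :
    Injective (c.halfDisc f) :=
  c.injective.comp (leftInverse_halfDiscUnlift hfinv).injective

/-- **The inverse of the half-disc is smooth on its range**, by descent along the collar: near
each point of `f(ℝⁿ⁺¹) × [0, 1/2)` the composite `k⁻¹ ∘ c` is the smooth map `G`, and the collar
is an immersion open at points of height `< 1` (Kosinski (1993), VI.1). [cite: Kosinski1993, Ch. VI §1, proof of Thm (1.1)] -/
theorem contMDiffOn_symm_toOpenPartialHomeomorph_halfDisc [IsManifold (𝓡∂ (n + 2)) ∞ A]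
    (hk : IsOpenEmbedding (c.halfDisc f)) {finv : b.carrier → 𝔼 (n + 1)}
    (hfinv : LeftInverse finv f)
    (hG : ContMDiffOn ((𝓡 (n + 1)).prod (𝓡∂ 1)) (𝓡∂ (n + 2)) ∞ (halfDiscUnlift finv)
      (halfDiscLiftRange f))
    (hfo : IsOpen (range f)) :
    ContMDiffOn (𝓡∂ (n + 2)) (𝓡∂ (n + 2)) ∞
      ((hk.toOpenPartialHomeomorph (c.halfDisc f)).symm : A → EuclideanHalfSpace (n + 2))
      (range (c.halfDisc f)) := by
  rintro _ ⟨v, rfl⟩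
  apply ContMDiffAt.contMDiffWithinAt
  set F : A → EuclideanHalfSpace (n + 2) :=
    ((hk.toOpenPartialHomeomorph (c.halfDisc f)).symm : A → EuclideanHalfSpace (n + 2))
  have hopen : halfDiscLiftRange f ∈ 𝓝 (halfDiscLift f v) :=
    (isOpen_halfDiscLiftRange hfo).mem_nhds (halfDiscLift_mem f v)
  have key : ContMDiffAt ((𝓡 (n + 1)).prod (𝓡∂ 1)) (𝓡∂ (n + 2)) ∞ (fun q => F (c q))
      (halfDiscLift f v) := by
    have hev : (fun q => F (c q)) =ᶠ[𝓝 (halfDiscLift f v)] halfDiscUnlift finv := by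
      filter_upwards [hopen] with q hq
      obtain ⟨w, rfl⟩ : q ∈ range (halfDiscLift f) := by rwa [range_halfDiscLift hfinv]
      rw [halfDiscUnlift_halfDiscLift hfinv]
      exact hk.toOpenPartialHomeomorph_left_inv (f := c.halfDisc f)
    exact ((hG _ (halfDiscLift_mem f v)).contMDiffAt hopen).congr_of_eventuallyEq hev
  change ContMDiffAt (𝓡∂ (n + 2)) (𝓡∂ (n + 2)) ∞ F (c (halfDiscLift f v))
  exact contMDiffAt_of_comp_isImmersionAt_of_nhds
    (c.isSmoothEmbedding.isImmersion.isImmersionAt (halfDiscLift f v))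
    (fun U hU => c.image_mem_nhds (halfDiscLift_snd_lt_one f v) hU) key fun _ => rfl

/-- **The half-disc of a collar along a smooth disc of the boundary is a smooth embedding of
the closed half space** (`Manifold.IsSmoothEmbedding` for `𝓡∂ (n + 2)` on both sides), with
open range. Hirsch, *Differential Topology* (1976), §4.6. [cite: Hirsch1976, §4.6] -/
theorem isSmoothEmbedding_halfDisc [IsManifold (𝓡∂ (n + 2)) ∞ A]
    (hf : Manifold.IsSmoothEmbedding (𝓡 (n + 1)) (𝓡 (n + 1)) ∞ f) (hfo : IsOpen (range f)) :
    Manifold.IsSmoothEmbedding (𝓡∂ (n + 2)) (𝓡∂ (n + 2)) ∞ (c.halfDisc f) ∧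
      IsOpen (range (c.halfDisc f)) := by
  -- a left inverse of `f`, smooth on the (open) range of `f`
  set finv : b.carrier → 𝔼 (n + 1) := invFun f
  have hfinv : LeftInverse finv f := leftInverse_invFun hf.isEmbedding.injective
  have hfinv' : ContMDiffOn (𝓡 (n + 1)) (𝓡 (n + 1)) ∞ finv (range f) :=
    contMDiffOn_leftInverse_of_isImmersion hf.isImmersion hf.isEmbedding hfinv
  have hG := contMDiffOn_halfDiscUnlift hfinv'
  have hk : IsOpenEmbedding (c.halfDisc f) :=
    .of_continuous_injective_isOpenMap (c.contMDiff_halfDisc hf.contMDiff).continuous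
      (c.injective_halfDisc hfinv) (c.isOpenMap_halfDisc hfinv hG.continuousOn hfo)
  refine ⟨?_, c.isOpen_range_halfDisc hfinv hG.continuousOn hfo⟩
  refine isSmoothEmbedding_of_symm_trans_chartAt_mem_maximalAtlas (I := 𝓡∂ (n + 2))
    (I' := 𝓡∂ (n + 2)) hk (Homeomorph.refl _) (ContinuousLinearEquiv.refl ℝ (𝔼 (n + 2)))
    (fun _ => rfl) ?_
  intro _ a
  simp only [chartAt_self_eq, OpenPartialHomeomorph.trans_refl,
    Homeomorph.refl_toOpenPartialHomeomorph]
  apply OpenPartialHomeomorph.mem_maximalAtlas_of_contMDiffOn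
  · rw [OpenPartialHomeomorph.symm_source, hk.toOpenPartialHomeomorph_target]
    exact c.contMDiffOn_symm_toOpenPartialHomeomorph_halfDisc hk hfinv hG hfo
  · rw [OpenPartialHomeomorph.symm_symm, OpenPartialHomeomorph.symm_target,
      hk.toOpenPartialHomeomorph_source, hk.toOpenPartialHomeomorph_apply]
    exact (c.contMDiff_halfDisc hf.contMDiff).contMDiffOn

end BoundaryData.Collar

end HalfDisc

/-! ### §4 The named fact from the collar theorem -/

/-- **Half-discs with prescribed flat face exist, given collars**: the named fact
`Literature.Topology.FourManifolds.exists_halfDisc_face_eq` (`CorkDecompositionSplitting.lean`) follows from the collar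
theorem `Literature.Topology.FourManifolds.BoundaryData.nonempty_collar` (`Gluing.lean`; Hirsch, *Differential Topology*
(1976), Thm. 4.6.1), by the construction `k (x₀, x') = c (f x', σ x₀)` of this file. [cite: Hirsch1976, Thm. 4.6.1 (collaring theorem)] -/
theorem exists_halfDisc_face_eq_of_nonempty_collar (h : BoundaryData.nonempty_collar.{u}) :
    exists_halfDisc_face_eq.{u} := by
  intro n A _ _ _ _ _ b f hf hfo
  obtain ⟨c⟩ := h n A b
  obtain ⟨hk, hko⟩ := c.isSmoothEmbedding_halfDisc hf hfo
  exact ⟨c.halfDisc f, hk, hko, c.halfDisc_face f⟩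

end Literature.Topology.FourManifolds
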